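import Mathlib.Data.Nat.Dist
import Mathlib.Analysis.SpecificLimits.Basic
import Mathlib.Analysis.Normed.Group.InfiniteSum
import Mathlib.Topology.Algebra.InfiniteSum.Real
import Mathlib.Algebra.Order.BigOperators.Group.Finset
import Mathlib.Tactic.LinearCombination
import Mathlib.Tactic.Positivity
import Mathlib.Tactic.GCongr
import Mathlib.Tactic.FieldSimp
import HarnessLib

/-!
# A Cesàro lemma for double sums of exponentially clustering, bulk-convergent arrays

Helper file for item `stmt-AtomisticToContinuum-12398` (`SpecificHeatLimit`, route `HeatModeWeylLaw`
of `AtomisticToContinuum/FouriersLaw`): the real-analysis step turning uniform exponential decay of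
finite-volume covariances `c n l m` (`|c n l m| ≤ C₁ r^{|l-m|}`) and their convergence in the bulk
(`|c n l m - C(|l-m|)| ≤ C₂ (r^{min l m} + r^{n-1-max l m})`, `|C(d)| ≤ C₃ rᵈ`) into the
thermodynamic limit of the variance per site,
`(1/n) ∑_{l,m<n} c n l m → C(0) + 2 ∑_{d≥1} C(d)`.

* `sum_range_dist` — reindexing `∑_{m<n} F(|l-m|)` by the distance;
* `abs_rowSum_le` — uniform bound on the row sums;
* `rowSum_bulk` — convergence of the row sums for rows far from both ends;
* `tendsto_cesaro_of_bulk` — Cesàro averaging of bounded, bulk-convergent rows;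
* `tendsto_sum_sum_div` (**main**).

All [folklore]; Mathlib only; no definitions.
-/

noncomputable section

open Filter Topology Finset

namespace Summit.AtomisticToContinuum.FouriersLaw.Theorems.SpecificHeatLimit

/-! ### Reindexing by the distance -/

/-- `∑_{m<n} F(|l-m|) = F 0 + ∑_{d<l} F(d+1) + ∑_{d<n-1-l} F(d+1)` for `l < n`. [folklore] -/
theorem sum_range_dist (F : ℕ → ℝ) {l n : ℕ} (hl : l < n) :
    ∑ m ∈ range n, F (Nat.dist l m) =
      F 0 + ∑ d ∈ range l, F (d + 1) + ∑ d ∈ range (n - 1 - l), F (d + 1) := by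
  rw [Finset.range_eq_Ico]
  rw [← Finset.sum_Ico_consecutive _ (Nat.zero_le l) hl.le,
    ← Finset.sum_Ico_consecutive _ (Nat.le_succ l) (Nat.succ_le_of_lt hl)]
  have h1 : ∑ m ∈ Ico 0 l, F (Nat.dist l m) = ∑ d ∈ range l, F (d + 1) := by
    rw [← Finset.range_eq_Ico, ← Finset.sum_range_reflect]
    refine Finset.sum_congr rfl fun d hd => ?_
    rw [Finset.mem_range] at hd
    congr 1
    rw [Nat.dist_comm, Nat.dist_eq_sub_of_le (by omega)]
    omega
  have h2 : ∑ m ∈ Ico l (l + 1), F (Nat.dist l m) = F 0 := by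
    rw [Nat.Ico_succ_singleton, Finset.sum_singleton, Nat.dist_self]
  have h3 : ∑ m ∈ Ico (l + 1) n, F (Nat.dist l m) = ∑ d ∈ range (n - 1 - l), F (d + 1) := by
    rw [Finset.sum_Ico_eq_sum_range, show n - (l + 1) = n - 1 - l by omega]
    refine Finset.sum_congr rfl fun d hd => ?_
    congr 1
    rw [Nat.dist_eq_sub_of_le (by omega)]
    omega
  rw [h1, h2, h3]
  ring

/-- `∑_{m<n} F(|l-m|) ≤ F 0 + 2 ∑' d, F(d+1)` for a nonnegative summable `F (· + 1)` and `l < n`.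
[folklore] -/
theorem sum_range_dist_le {F : ℕ → ℝ} (hF0 : ∀ d, 0 ≤ F (d + 1))
    (hF : Summable fun d => F (d + 1)) {l n : ℕ} (hl : l < n) :
    ∑ m ∈ range n, F (Nat.dist l m) ≤ F 0 + 2 * ∑' d, F (d + 1) := by
  rw [sum_range_dist F hl, two_mul, add_assoc]
  gcongr
  · exact hF.sum_le_tsum _ fun d _ => hF0 d
  · exact hF.sum_le_tsum _ fun d _ => hF0 d

/-! ### Geometric bookkeeping -/

/-- `∑' d, r^(d+k+1) = r^(k+1) / (1 - r)`. [folklore] -/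
theorem tsum_geometric_shift {r : ℝ} (hr0 : 0 ≤ r) (hr1 : r < 1) (k : ℕ) :
    ∑' d : ℕ, r ^ (d + k + 1) = r ^ (k + 1) / (1 - r) := by
  have h : (fun d : ℕ => r ^ (d + k + 1)) = fun d => r ^ (k + 1) * r ^ d := by
    funext d; rw [← pow_add]; congr 1; omega
  rw [h, tsum_mul_left, tsum_geometric_of_lt_one hr0 hr1, div_eq_mul_inv]

/-- Tails of a geometrically dominated sequence: `|∑' d, f (d + k)| ≤ C rᵏ / (1 - r)`. [folklore] -/
theorem abs_tsum_tail_le {f : ℕ → ℝ} {C r : ℝ} (hr0 : 0 ≤ r) (hr1 : r < 1)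
    (hf : ∀ d, |f d| ≤ C * r ^ d) (k : ℕ) : |∑' d, f (d + k)| ≤ C * r ^ k / (1 - r) := by
  have hC : 0 ≤ C := by
    have := hf 0; rw [pow_zero, mul_one] at this; exact (abs_nonneg _).trans this
  have hg : Summable fun d : ℕ => C * r ^ (d + k) := by
    have : (fun d : ℕ => C * r ^ (d + k)) = fun d => C * r ^ k * r ^ d := by
      funext d; rw [pow_add]; ring
    rw [this]
    exact (summable_geometric_of_lt_one hr0 hr1).mul_left _
  have hfs : Summable fun d => f (d + k) :=
    Summable.of_norm_bounded hg fun d => by rw [Real.norm_eq_abs]; exact hf (d + k)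
  have hfa : Summable fun d => |f (d + k)| := hfs.abs
  calc |∑' d, f (d + k)| ≤ ∑' d, |f (d + k)| := by
        have hfa' : Summable fun d => ‖f (d + k)‖ := by simpa only [Real.norm_eq_abs] using hfa
        have := norm_tsum_le_tsum_norm hfa'
        simpa only [Real.norm_eq_abs] using this
    _ ≤ ∑' d, C * r ^ (d + k) := hfa.tsum_le_tsum (fun d => hf (d + k)) hg
    _ = C * r ^ k / (1 - r) := by
        have : (fun d : ℕ => C * r ^ (d + k)) = fun d => C * r ^ k * r ^ d := by
          funext d; rw [pow_add]; ring
        rw [this, tsum_mul_left, tsum_geometric_of_lt_one hr0 hr1, div_eq_mul_inv]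

/-! ### Row sums -/

section Rows

variable {c : ℕ → ℕ → ℕ → ℝ} {Cf : ℕ → ℝ} {C₁ C₂ C₃ r : ℝ}

/-- **Uniform bound on the row sums**: `|∑_{m<n} c n l m| ≤ C₁ (1 + 2 r/(1-r))`. [folklore] -/
theorem abs_rowSum_le (hr0 : 0 ≤ r) (hr1 : r < 1)
    (h1 : ∀ n l m, l < n → m < n → |c n l m| ≤ C₁ * r ^ Nat.dist l m) {n l : ℕ} (hl : l < n) :
    |∑ m ∈ range n, c n l m| ≤ C₁ * (1 + 2 * (r / (1 - r))) := by
  have hC₁ : 0 ≤ C₁ := by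
    have := h1 n l l hl hl; rw [Nat.dist_self, pow_zero, mul_one] at this
    exact (abs_nonneg _).trans this
  have hgeo : Summable fun d : ℕ => r ^ (d + 1) := by
    simp_rw [pow_succ]; exact (summable_geometric_of_lt_one hr0 hr1).mul_right r
  have htsum : ∑' d : ℕ, r ^ (d + 1) = r / (1 - r) := by
    have := tsum_geometric_shift hr0 hr1 0
    simpa only [add_zero, zero_add, pow_one] using this
  calc |∑ m ∈ range n, c n l m| ≤ ∑ m ∈ range n, |c n l m| := Finset.abs_sum_le_sum_abs _ _
    _ ≤ ∑ m ∈ range n, C₁ * r ^ Nat.dist l m :=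
        Finset.sum_le_sum fun m hm => h1 n l m hl (Finset.mem_range.1 hm)
    _ = C₁ * ∑ m ∈ range n, r ^ Nat.dist l m := by rw [Finset.mul_sum]
    _ ≤ C₁ * (r ^ 0 + 2 * ∑' d, r ^ (d + 1)) := by
        gcongr
        exact sum_range_dist_le (F := fun d => r ^ d) (fun d => pow_nonneg hr0 _) hgeo hl
    _ = C₁ * (1 + 2 * (r / (1 - r))) := by rw [pow_zero, htsum]

/-- **Bulk convergence of the row sums**: for every `ε > 0` there is `L` such that
`|∑_{m<n} c n l m - (C(0) + 2∑_{d≥1} C(d))| ≤ ε` whenever `L ≤ l` and `l + L < n`. [folklore] -/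
theorem rowSum_bulk (hr0 : 0 ≤ r) (hr1 : r < 1)
    (h1 : ∀ n l m, l < n → m < n → |c n l m| ≤ C₁ * r ^ Nat.dist l m)
    (h2 : ∀ n l m, l < n → m < n →
      |c n l m - Cf (Nat.dist l m)| ≤ C₂ * (r ^ min l m + r ^ (n - 1 - max l m)))
    (h3 : ∀ d, |Cf d| ≤ C₃ * r ^ d) {ε : ℝ} (hε : 0 < ε) :
    ∃ L : ℕ, ∀ n l, L ≤ l → l + L < n →
      |∑ m ∈ range n, c n l m - (Cf 0 + 2 * ∑' d, Cf (d + 1))| ≤ ε := by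
  -- signs of the constants
  have hC₁ : 0 ≤ C₁ := by
    have := h1 1 0 0 one_pos one_pos; rw [Nat.dist_self, pow_zero, mul_one] at this
    exact (abs_nonneg _).trans this
  have hC₂ : 0 ≤ C₂ := by
    have := h2 1 0 0 one_pos one_pos
    simp only [Nat.dist_self, min_self, max_self, Nat.sub_self, pow_zero] at this
    nlinarith [abs_nonneg (c 1 0 0 - Cf 0)]
  have hC₃ : 0 ≤ C₃ := by
    have := h3 0; rw [pow_zero, mul_one] at this; exact (abs_nonneg _).trans this
  have h1r : 0 < 1 - r := by linarith
  -- choice of `D`: the far field `2 (C₁ + C₃) r^{D+1}/(1-r) ≤ ε/3`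
  have htend : Tendsto (fun D : ℕ => r ^ D) atTop (𝓝 0) :=
    tendsto_pow_atTop_nhds_zero_of_lt_one hr0 hr1
  have hε3 : 0 < ε / 3 := by positivity
  obtain ⟨D, hD⟩ : ∃ D : ℕ, 2 * (C₁ + C₃) * r ^ (D + 1) / (1 - r) ≤ ε / 3 := by
    have ht : Tendsto (fun D : ℕ => 2 * (C₁ + C₃) * r ^ (D + 1) / (1 - r)) atTop (𝓝 0) := by
      have := ((htend.comp (tendsto_add_atTop_nat 1)).const_mul (2 * (C₁ + C₃))).div_const (1 - r)
      simpa using this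
    exact (ht.eventually (ge_mem_nhds hε3)).exists
  -- choice of `L ≥ D`: the near field `2 C₂ (2D+1) r^{L-D} ≤ ε/3` and the tails `2 C₃ r^L/(1-r) ≤ ε/3`
  obtain ⟨L₀, hL₀⟩ : ∃ L₀ : ℕ, ∀ L, L₀ ≤ L →
      2 * C₂ * (2 * D + 1) * r ^ L ≤ ε / 3 ∧ 2 * C₃ * r ^ L / (1 - r) ≤ ε / 3 := by
    have ht1 : Tendsto (fun L : ℕ => 2 * C₂ * (2 * D + 1) * r ^ L) atTop (𝓝 0) := by
      simpa using htend.const_mul (2 * C₂ * (2 * D + 1))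
    have ht2 : Tendsto (fun L : ℕ => 2 * C₃ * r ^ L / (1 - r)) atTop (𝓝 0) := by
      simpa using (htend.const_mul (2 * C₃)).div_const (1 - r)
    obtain ⟨L₀, hL₀⟩ := eventually_atTop.1 ((ht1.eventually (ge_mem_nhds hε3)).and
      (ht2.eventually (ge_mem_nhds hε3)))
    exact ⟨L₀, hL₀⟩
  refine ⟨L₀ + D, fun n l hLl hln => ?_⟩
  have hl : l < n := by omega
  set m' : ℕ := n - 1 - l with hm'
  -- `q + D ≤ min l m'`, `L₀ ≤ q`
  set q : ℕ := min l m' - D with hq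
  have hql : q + D ≤ l := by omega
  have hqm : q + D ≤ m' := by omega
  obtain ⟨hnear, htail⟩ := hL₀ q (by omega)
  have hrq : ∀ k, q ≤ k → r ^ k ≤ r ^ q := fun k hk => pow_le_pow_of_le_one hr0 hr1.le hk
  -- ### Step 1: the recentred terms, bounded by a function of the distance
  set e : ℕ → ℝ := fun d => if d ≤ D then 2 * C₂ * r ^ q else (C₁ + C₃) * r ^ d with he
  have he0 : ∀ d, 0 ≤ e d := fun d => by
    rw [he]; dsimp only; split_ifs <;> positivity
  have hterm : ∀ m, m < n → |c n l m - Cf (Nat.dist l m)| ≤ e (Nat.dist l m) := by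
    intro m hm
    rw [he]; dsimp only
    split_ifs with hd
    · -- near field: both `min l m` and `n-1-max l m` are at least `q`
      have hmm : q ≤ min l m ∧ q ≤ n - 1 - max l m := by
        rcases le_total l m with h | h
        · rw [Nat.dist_eq_sub_of_le h] at hd
          rw [min_eq_left h, max_eq_right h]
          omega
        · rw [Nat.dist_comm, Nat.dist_eq_sub_of_le h] at hd
          rw [min_eq_right h, max_eq_left h]
          omega
      calc |c n l m - Cf (Nat.dist l m)| ≤ C₂ * (r ^ min l m + r ^ (n - 1 - max l m)) :=
            h2 n l m hl hm
        _ ≤ C₂ * (r ^ q + r ^ q) :=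
            mul_le_mul_of_nonneg_left (add_le_add (hrq _ hmm.1) (hrq _ hmm.2)) hC₂
        _ = 2 * C₂ * r ^ q := by ring
    · calc |c n l m - Cf (Nat.dist l m)| ≤ |c n l m| + |Cf (Nat.dist l m)| := abs_sub _ _
        _ ≤ C₁ * r ^ Nat.dist l m + C₃ * r ^ Nat.dist l m := add_le_add (h1 n l m hl hm) (h3 _)
        _ = (C₁ + C₃) * r ^ Nat.dist l m := by ring
  -- summing `e` over the distances
  have heD : ∀ d, e (d + D + 1) = (C₁ + C₃) * r ^ (d + D + 1) := fun d => by
    rw [he]; dsimp only; rw [if_neg (by omega)]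
  have hes : Summable fun d => e (d + 1) := by
    rw [← summable_nat_add_iff D]
    have : (fun d => e (d + D + 1)) = fun d => (C₁ + C₃) * r ^ (D + 1) * r ^ d := by
      funext d
      rw [heD, show d + D + 1 = (D + 1) + d by ring, pow_add]
      ring
    rw [this]
    exact (summable_geometric_of_lt_one hr0 hr1).mul_left _
  have hesum : ∑' d, e (d + 1) = D * (2 * C₂ * r ^ q) + (C₁ + C₃) * r ^ (D + 1) / (1 - r) := by
    rw [← hes.sum_add_tsum_nat_add D]
    congr 1
    · have : ∑ i ∈ range D, e (i + 1) = ∑ _i ∈ range D, 2 * C₂ * r ^ q :=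
        Finset.sum_congr rfl fun d hd => by
          rw [Finset.mem_range] at hd
          rw [he]; dsimp only; rw [if_pos (by omega)]
      rw [this, Finset.sum_const, Finset.card_range, nsmul_eq_mul]
    · simp_rw [heD]
      rw [tsum_mul_left, tsum_geometric_shift hr0 hr1 D, mul_div_assoc]
  have hfirst : |∑ m ∈ range n, (c n l m - Cf (Nat.dist l m))| ≤ ε / 3 + ε / 3 := by
    calc |∑ m ∈ range n, (c n l m - Cf (Nat.dist l m))|
        ≤ ∑ m ∈ range n, |c n l m - Cf (Nat.dist l m)| := Finset.abs_sum_le_sum_abs _ _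
      _ ≤ ∑ m ∈ range n, e (Nat.dist l m) :=
          Finset.sum_le_sum fun m hm => hterm m (Finset.mem_range.1 hm)
      _ ≤ e 0 + 2 * ∑' d, e (d + 1) := sum_range_dist_le (fun d => he0 _) hes hl
      _ = 2 * C₂ * (2 * D + 1) * r ^ q + 2 * (C₁ + C₃) * r ^ (D + 1) / (1 - r) := by
          rw [hesum, he]; dsimp only; rw [if_pos (Nat.zero_le D)]; ring
      _ ≤ ε / 3 + ε / 3 := add_le_add hnear hD
  -- ### Step 2: the tails of the bulk series
  have hCfb : ∀ d, |Cf (d + 1)| ≤ C₃ * r * r ^ d := fun d =>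
    calc |Cf (d + 1)| ≤ C₃ * r ^ (d + 1) := h3 _
      _ = C₃ * r * r ^ d := by rw [pow_succ]; ring
  have hCfs : Summable fun d => Cf (d + 1) :=
    Summable.of_norm_bounded ((summable_geometric_of_lt_one hr0 hr1).mul_left (C₃ * r))
      fun d => by rw [Real.norm_eq_abs]; exact hCfb d
  have htailb : ∀ k, q ≤ k → |∑' d, Cf (d + k + 1)| ≤ C₃ * r ^ q / (1 - r) := by
    intro k hk
    have h := abs_tsum_tail_le (f := fun d => Cf (d + 1)) hr0 hr1 hCfb k
    calc |∑' d, Cf (d + k + 1)| ≤ C₃ * r * r ^ k / (1 - r) := h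
      _ ≤ C₃ * 1 * r ^ q / (1 - r) := by
          refine div_le_div_of_nonneg_right ?_ h1r.le
          exact mul_le_mul (mul_le_mul_of_nonneg_left hr1.le hC₃) (hrq k hk) (pow_nonneg hr0 _)
            (by positivity)
      _ = C₃ * r ^ q / (1 - r) := by ring
  have hsecond : |∑ m ∈ range n, Cf (Nat.dist l m) - (Cf 0 + 2 * ∑' d, Cf (d + 1))| ≤ ε / 3 := by
    rw [sum_range_dist Cf hl]
    have el : ∑ d ∈ range l, Cf (d + 1) + ∑' d, Cf (d + l + 1) = ∑' d, Cf (d + 1) :=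
      hCfs.sum_add_tsum_nat_add l
    have em : ∑ d ∈ range m', Cf (d + 1) + ∑' d, Cf (d + m' + 1) = ∑' d, Cf (d + 1) :=
      hCfs.sum_add_tsum_nat_add m'
    have e2 : Cf 0 + ∑ d ∈ range l, Cf (d + 1) + ∑ d ∈ range (n - 1 - l), Cf (d + 1) -
        (Cf 0 + 2 * ∑' d, Cf (d + 1)) = -(∑' d, Cf (d + l + 1) + ∑' d, Cf (d + m' + 1)) := by
      rw [← hm']
      linear_combination el + em
    rw [e2, abs_neg]
    calc |∑' d, Cf (d + l + 1) + ∑' d, Cf (d + m' + 1)|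
        ≤ |∑' d, Cf (d + l + 1)| + |∑' d, Cf (d + m' + 1)| := abs_add_le _ _
      _ ≤ C₃ * r ^ q / (1 - r) + C₃ * r ^ q / (1 - r) :=
          add_le_add (htailb l (by omega)) (htailb m' (by omega))
      _ = 2 * C₃ * r ^ q / (1 - r) := by ring
      _ ≤ ε / 3 := htail
  -- ### conclusion
  have hsplit : ∑ m ∈ range n, c n l m - (Cf 0 + 2 * ∑' d, Cf (d + 1)) =
      ∑ m ∈ range n, (c n l m - Cf (Nat.dist l m)) +
        (∑ m ∈ range n, Cf (Nat.dist l m) - (Cf 0 + 2 * ∑' d, Cf (d + 1))) := by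
    rw [Finset.sum_sub_distrib]; ring
  rw [hsplit]
  calc _ ≤ |∑ m ∈ range n, (c n l m - Cf (Nat.dist l m))| +
        |∑ m ∈ range n, Cf (Nat.dist l m) - (Cf 0 + 2 * ∑' d, Cf (d + 1))| := abs_add_le _ _
    _ ≤ ε / 3 + ε / 3 + ε / 3 := add_le_add hfirst hsecond
    _ = ε := by ring

end Rows

/-! ### Cesàro averaging of bounded, bulk-convergent rows -/

/-- **Cesàro lemma.** If `|ρ n l| ≤ B` for `l < n` and for every `ε > 0` there is `L` with
`|ρ n l - σ| ≤ ε` whenever `L ≤ l` and `l + L < n`, then `(1/n) ∑_{l<n} ρ n l → σ`. [folklore] -/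
theorem tendsto_cesaro_of_bulk {ρ : ℕ → ℕ → ℝ} {B σ : ℝ} (hB : ∀ n l, l < n → |ρ n l| ≤ B)
    (hbulk : ∀ ε : ℝ, 0 < ε → ∃ L : ℕ, ∀ n l, L ≤ l → l + L < n → |ρ n l - σ| ≤ ε) :
    Tendsto (fun n : ℕ => (∑ l ∈ range n, ρ n l) / n) atTop (𝓝 σ) := by
  rw [Metric.tendsto_atTop]
  intro ε hε
  have hε3 : 0 < ε / 3 := by positivity
  obtain ⟨L, hL⟩ := hbulk (ε / 3) hε3
  have hB0 : 0 ≤ B + |σ| := by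
    have := hB 1 0 one_pos
    exact add_nonneg ((abs_nonneg _).trans this) (abs_nonneg _)
  -- `N` with `2L(B + |σ|)/N ≤ ε/3` and `N > 2L`
  obtain ⟨N, hN⟩ : ∃ N : ℕ, ∀ n, N ≤ n → 2 * L * (B + |σ|) / n ≤ ε / 3 ∧ 2 * L < n := by
    have ht : Tendsto (fun n : ℕ => 2 * L * (B + |σ|) / (n : ℝ)) atTop (𝓝 0) :=
      tendsto_const_div_atTop_nhds_zero_nat _
    obtain ⟨N, hN⟩ := eventually_atTop.1 ((ht.eventually (ge_mem_nhds hε3)).and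
      (eventually_gt_atTop (2 * L)))
    exact ⟨N, hN⟩
  refine ⟨max N 1, fun n hn => ?_⟩
  obtain ⟨hN1, hN2⟩ := hN n (le_of_max_le_left hn)
  have hn1 : 1 ≤ n := le_of_max_le_right hn
  have hn0 : (0 : ℝ) < n := by exact_mod_cast hn1
  rw [Real.dist_eq]
  -- recentre
  have hre : (∑ l ∈ range n, ρ n l) / n - σ = (∑ l ∈ range n, (ρ n l - σ)) / n := by
    rw [Finset.sum_sub_distrib, Finset.sum_const, Finset.card_range, nsmul_eq_mul]
    field_simp
  rw [hre, abs_div, abs_of_pos hn0, div_lt_iff₀ hn0]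
  -- split the rows into bulk and boundary ones
  set bulk : Finset ℕ := (range n).filter fun l => L ≤ l ∧ l + L < n with hbulkdef
  set bdry : Finset ℕ := (range n).filter fun l => ¬ (L ≤ l ∧ l + L < n) with hbdrydef
  have hsplit : ∑ l ∈ range n, (ρ n l - σ) = ∑ l ∈ bulk, (ρ n l - σ) + ∑ l ∈ bdry, (ρ n l - σ) :=
    (Finset.sum_filter_add_sum_filter_not _ _ _).symm
  have hbulk_le : |∑ l ∈ bulk, (ρ n l - σ)| ≤ n * (ε / 3) := by
    calc |∑ l ∈ bulk, (ρ n l - σ)| ≤ ∑ l ∈ bulk, |ρ n l - σ| := Finset.abs_sum_le_sum_abs _ _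
      _ ≤ ∑ _l ∈ bulk, ε / 3 := Finset.sum_le_sum fun l hl => by
          rw [hbulkdef, Finset.mem_filter] at hl
          exact hL n l hl.2.1 hl.2.2
      _ = bulk.card * (ε / 3) := by rw [Finset.sum_const, nsmul_eq_mul]
      _ ≤ n * (ε / 3) := by
          gcongr
          calc bulk.card ≤ (range n).card := Finset.card_filter_le _ _
            _ = n := Finset.card_range n
  have hbdry_card : bdry.card ≤ 2 * L := by
    have hsub : bdry ⊆ range L ∪ Finset.Ico (n - L) n := by
      intro l hl
      rw [hbdrydef, Finset.mem_filter, Finset.mem_range] at hl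
      rw [Finset.mem_union, Finset.mem_range, Finset.mem_Ico]
      omega
    calc bdry.card ≤ (range L ∪ Finset.Ico (n - L) n).card := Finset.card_le_card hsub
      _ ≤ (range L).card + (Finset.Ico (n - L) n).card := Finset.card_union_le _ _
      _ = L + (n - (n - L)) := by rw [Finset.card_range, Nat.card_Ico]
      _ ≤ 2 * L := by omega
  have hbdry_le : |∑ l ∈ bdry, (ρ n l - σ)| ≤ 2 * L * (B + |σ|) := by
    calc |∑ l ∈ bdry, (ρ n l - σ)| ≤ ∑ l ∈ bdry, |ρ n l - σ| := Finset.abs_sum_le_sum_abs _ _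
      _ ≤ ∑ _l ∈ bdry, (B + |σ|) := Finset.sum_le_sum fun l hl => by
          rw [hbdrydef, Finset.mem_filter, Finset.mem_range] at hl
          calc |ρ n l - σ| ≤ |ρ n l| + |σ| := abs_sub _ _
            _ ≤ B + |σ| := add_le_add (hB n l hl.1) le_rfl
      _ = bdry.card * (B + |σ|) := by rw [Finset.sum_const, nsmul_eq_mul]
      _ ≤ (2 * L : ℕ) * (B + |σ|) := by gcongr
      _ = 2 * L * (B + |σ|) := by push_cast; ring
  have hbd : 2 * L * (B + |σ|) ≤ n * (ε / 3) := by
    rw [div_le_iff₀ hn0] at hN1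
    linarith
  rw [hsplit]
  calc |∑ l ∈ bulk, (ρ n l - σ) + ∑ l ∈ bdry, (ρ n l - σ)|
      ≤ |∑ l ∈ bulk, (ρ n l - σ)| + |∑ l ∈ bdry, (ρ n l - σ)| := abs_add_le _ _
    _ ≤ n * (ε / 3) + n * (ε / 3) := add_le_add hbulk_le (hbdry_le.trans hbd)
    _ < ε * n := by nlinarith

/-! ### The main statement -/

/-- **Thermodynamic limit of a double sum of exponentially clustering, bulk-convergent arrays.**
If `|c n l m| ≤ C₁ r^{|l-m|}`, `|c n l m - C(|l-m|)| ≤ C₂ (r^{min l m} + r^{n-1-max l m})` for all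
`l, m < n`, and `|C(d)| ≤ C₃ rᵈ` (`0 ≤ r < 1`), then
`(1/n) ∑_{l<n} ∑_{m<n} c n l m → C(0) + 2 ∑_{d≥0} C(d+1)` — the form in which the variance per
site of a sum of bond observables of a one-dimensional Gibbs state converges to the sum of the
infinite-volume covariances. [folklore] -/
theorem tendsto_sum_sum_div {c : ℕ → ℕ → ℕ → ℝ} {Cf : ℕ → ℝ} {C₁ C₂ C₃ r : ℝ}
    (hr0 : 0 ≤ r) (hr1 : r < 1)
    (h1 : ∀ n l m, l < n → m < n → |c n l m| ≤ C₁ * r ^ Nat.dist l m)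
    (h2 : ∀ n l m, l < n → m < n →
      |c n l m - Cf (Nat.dist l m)| ≤ C₂ * (r ^ min l m + r ^ (n - 1 - max l m)))
    (h3 : ∀ d, |Cf d| ≤ C₃ * r ^ d) :
    Tendsto (fun n : ℕ => (∑ l ∈ range n, ∑ m ∈ range n, c n l m) / n) atTop
      (𝓝 (Cf 0 + 2 * ∑' d, Cf (d + 1))) :=
  tendsto_cesaro_of_bulk (ρ := fun n l => ∑ m ∈ range n, c n l m)
    (fun _ _ hl => abs_rowSum_le hr0 hr1 h1 hl)
    (fun _ hε => rowSum_bulk hr0 hr1 h1 h2 h3 hε)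

end Summit.AtomisticToContinuum.FouriersLaw.Theorems.SpecificHeatLimit

end
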